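import Summits.BirchSwinnertonDyer.BirchSwinnertonDyer.Theses.ByReductionTypeAtTwo
import Summits.BirchSwinnertonDyer.BirchSwinnertonDyer.Theorems.AlignedTransportAtTwoMainConjectureOfRankZeroBSDAtTwoTorsionPointFieldDoors
import Summits.BirchSwinnertonDyer.BirchSwinnertonDyer.Theorems.ByReductionTypeAtTwoOrdKatoHalfAtTwoIsoConjATwoOfPointFieldMu
import Literature.NumberTheory.EllipticCurves.Kato2004.SemistableRankZeroShaUpperBoundFineSelmerAtTwoSharp
import Literature.NumberTheory.EllipticCurves.Kato2004.AdditiveNoSplitCyclotomicTwistRankZeroShaUpperBoundFineSelmerAtTwoSharp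
import Literature.NumberTheory.EllipticCurves.SelmerGroupCardinality
import Literature.NumberTheory.EllipticCurves.Rank1Residual.X10Proofs
import Literature.NumberTheory.EllipticCurves.LeadingTerm
import HarnessLib

/-!
# ES-50 (-es g39, cell `bsd-f1-sign2`): THE KATO HALF OF THE `2`-ADIC DETECTION STATEMENT ES-48X IS TREE-READING + CONJECTURE A,
# AND CONJECTURE A AT `2` IS DECIDED ON THE `2`-TORSION POINT FIELD — UNIFORMLY IN THE TWIN FAMILY

Scoping workfile for crux `RankOneAtTwoBigImageOddLocal` (stmt-BirchSwinnertonDyer-23715).  SORRY-FREE.  Closes nothing; no item is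
booked; nothing is asserted about any curve or number field; BSD is not proved by any of this.  MEMO-es §48; census `CensusES50.md`
(kit j344462 / j344488 / j344508).  PARTITION 52421 = 17880 + 27650 + 3440 + 3451 (untouched).

WHAT.  The -es detection statement ES-48X («`#Ш_an(W₀)` odd ∧ `L(W₀,1) ≠ 0` ⟹ `Sel₂(W₀) = 0`» for the minimal twins `W₀` of a slice curve,
workfile `AnalyticSupplyAtTwoES48.lean`) was booked as «Kato 17.4 at `p ≠ 2` — not in print at `2`».  Its (⟸) = KATO HALF is here written
over the tree's own `p = 2` objects, all consumed BY NAME: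
* §2 kernel arithmetic: Kato's `2`-adic upper bound + `v₂(L/Ω) = v₂(∏c)` (odd torsion) + `Ш` finite ⟹ `Ш[2^∞] = 0`; with rank `0` and no
  rational `2`-torsion ⟹ `#Sel₂ = 1` (`card_selmerGroup_eq_pow_rank_mul`);
* §3 (A) at `(W, 2)` from FINITE CERTIFICATES of the cubic point field `ℚ(P)` (Iwasawa 1956 / Fukuda 1994 via the route's doors
  `…TorsionPointFieldDoors`, typed fact `hLim₂`) and — the honest `0 < Δ` door — of the totally complex sextic carrier `ℚ(P, i)` via the KERNEL
  Lim-at-`2` theorem `SteinbergFibreAtTwo.PointFieldMu.exists_fineSelmerDualData_moduleFinite_of_classicalMu_pointField_adjoin` (no `hLim`);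
* §4 `KatoHalfDetectionAtTwo` (ES-50K) ⟸ {GZK} ∪ {the three Kato-at-`2` READINGS} (`katoHalfDetectionAtTwo_of_readings`), and the twin-uniformity
  statement `TwinPointFieldUniform` (ES-50U, size S, OPEN here): `ℚ(P)` is invariant under quadratic twist, so ONE certificate of the base curve
  gives (A)₂ for EVERY twin (`conjATwo_twin_of_pointFieldIwasawaCertificate`, `conjATwo_twin_of_carrierIwasawaCertificate`);
* §4 (end) the conjecture-grade residue `SlicePointFieldMuZero` (ES-50R: `μ₂ = 0` for the cubic point fields of the slice — Greenberg territory).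
Census ES-50 (234 slice bases): honest certificates T1 123/234, typed-fact level T2 201/234; they carry 2407 resp. 3384 of the 3850 class-A
transposition rows of MT48, all of which have `Sel₂(W₀) = 0`.
-/

set_option autoImplicit false
-- the Cruxes namespace of this sub repeats the summit name by design (D-0017 nested layout)
set_option linter.dupNamespace false

noncomputable section

open scoped Classical

namespace Summit.BirchSwinnertonDyer.BirchSwinnertonDyer.Cruxes.RankOneAtTwoBigImageOddLocal.ES50

open WeierstrassCurve Field Literature.NumberTheory.EllipticCurves Literature.NumberTheory.GaloisRepresentations
  Literature.NumberTheory.IwasawaTheory IsDedekindDomain NumberField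
  Literature.NumberTheory.EllipticCurves.IwasawaModuleFinitePadicInt
  Summit.BirchSwinnertonDyer.BirchSwinnertonDyer.Theorems.AlignedTransportAtTwoTorsionPointField

/-! ## §1 Currencies -/

/-- **Statement (A) of Coates–Sujatha at `(E, 2)`** in the `∃ γ D` spelling of the tree's Kato-at-`2` readings: for every cyclotomic
`ℤ₂`-extension datum `κ` some Pontryagin-dual datum of `Sel₀(ℚ^cyc, E[2^∞])` is finitely generated over `ℤ₂`. -/
def ConjATwo (W : WeierstrassCurve ℚ) [W.IsElliptic] : Prop :=
  ∀ (κ : ZpExtension ℚ 2), κ.IsCyclotomic →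
    ∃ (γ : absoluteGaloisGroup ℚ) (D : W.FineSelmerDualData κ γ),
      Module.Finite ℤ_[2] (RestrictScalars ℤ_[2] (IwasawaAlgebra 2) D.X)

/-- **Analytic `2`-exactness in the `L/Ω` currency**: `L(E,1)/Ω` is a rational number whose `2`-adic valuation equals `v₂(∏ c_ℓ)`.
For a curve with `L(E,1) ≠ 0` and odd torsion this is «`r_an = 0` and `#Ш_an` is a `2`-adic unit» (ES-48 `ShaAnTwoUnit`). -/
def LOverOmegaTwoExact (W : WeierstrassCurve ℚ) [W.IsElliptic] : Prop :=
  ∃ q : ℚ, W.entireLFunction 1 / (W.realPeriodRat : ℂ) = (q : ℂ) ∧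
    padicValRat 2 q = padicValNat 2 W.tamagawaProduct

/-- **Kato-type upper bound at `2`** — the common conclusion of the tree's four rank-`0` readings of [Kato2004] at `p = 2`:
`L(E,1)/Ω = q ∈ ℚ` with `ord₂ #Ш(E)(2) + v₂(∏ c_ℓ) ≤ ord₂ q`. -/
def KatoUpperBoundAtTwo (W : WeierstrassCurve ℚ) [W.IsElliptic] : Prop :=
  ∃ q : ℚ, W.entireLFunction 1 / (W.realPeriodRat : ℂ) = (q : ℂ) ∧
    (padicValNat 2 (Nat.card (AddCommGroup.primaryComponent W.sha 2)) : ℤ) +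
        padicValNat 2 W.tamagawaProduct ≤ padicValRat 2 q

/-- **The Iwasawa-1956 certificate of a subfield `F ⊆ ℚ̄`**: odd class number and exactly one prime above `2`. -/
def FieldIwasawaCertificateAtTwo (F : IntermediateField ℚ (AlgebraicClosure ℚ)) : Prop :=
  ¬ 2 ∣ Nat.card (ClassGroup (𝓞 F)) ∧ ∃! v : HeightOneSpectrum (𝓞 F), ((2 : ℕ) : 𝓞 F) ∈ v.asIdeal

/-- **Iwasawa's `μ = 0` at `2` for a subfield `F ⊆ ℚ̄`** (growth form `ClassicalMuVanishes`, every cyclotomic `ℤ₂`-extension datum). -/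
def FieldMuZeroAtTwo (F : IntermediateField ℚ (AlgebraicClosure ℚ)) : Prop :=
  ∀ κL : ZpExtension F 2, κL.IsCyclotomic → ClassicalMuVanishes κL

/-- **The Iwasawa-1956 certificate on the `2`-torsion point field `ℚ(P) = ℚ̄^{Stab(P)}`.** -/
def PointFieldIwasawaCertificate (W : WeierstrassCurve ℚ) [W.IsElliptic] (P : geomTorsion W 2) : Prop :=
  FieldIwasawaCertificateAtTwo (IntermediateField.fixedField (MulAction.stabilizer (absoluteGaloisGroup ℚ) P))

/-! ## §2 Kernel bookkeeping: upper bound + exactness ⟹ `Ш[2^∞] = 0` ⟹ `#Sel₂ = 1` -/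

/-- Upper bound + analytic `2`-exactness force the `2`-primary part of a finite `Ш` to vanish. -/
theorem primaryComponent_sha_two_eq_bot (W : WeierstrassCurve ℚ) [W.IsElliptic] (hfin : Finite W.sha)
    (hU : KatoUpperBoundAtTwo W) (hx : LOverOmegaTwoExact W) :
    AddCommGroup.primaryComponent W.sha 2 = ⊥ := by
  obtain ⟨q, hq, hle⟩ := hU
  obtain ⟨q', hq', hv⟩ := hx
  have hqq : q' = q := by exact_mod_cast hq'.symm.trans hq
  subst hqq
  rw [hv] at hle
  have h0 : padicValNat 2 (Nat.card (AddCommGroup.primaryComponent W.sha 2)) = 0 := by omega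
  haveI : Finite (AddCommGroup.primaryComponent W.sha 2) := inferInstance
  have hcard : Nat.card (AddCommGroup.primaryComponent W.sha 2) ≠ 0 := Nat.card_pos.ne'
  have hndvd : ¬ 2 ∣ Nat.card (AddCommGroup.primaryComponent W.sha 2) := by
    rcases padicValNat.eq_zero_iff.mp h0 with h | h | h
    · norm_num at h
    · exact absurd h hcard
    · exact h
  refine (AddSubgroup.eq_bot_iff_forall _).mpr fun x hx => ?_
  obtain ⟨k, hk⟩ := AddCommGroup.mem_primaryComponent.mp hx
  set y : AddCommGroup.primaryComponent W.sha 2 := ⟨x, hx⟩ with hy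
  have h1 : addOrderOf y ∣ Nat.card (AddCommGroup.primaryComponent W.sha 2) := addOrderOf_dvd_natCard y
  have h2 : addOrderOf y ∣ 2 ^ k := by
    apply addOrderOf_dvd_of_nsmul_eq_zero
    exact Subtype.ext (by simpa [hy] using hk)
  have hcop : Nat.Coprime (Nat.card (AddCommGroup.primaryComponent W.sha 2)) (2 ^ k) :=
    Nat.Coprime.pow_right k ((Nat.Prime.coprime_iff_not_dvd Nat.prime_two).mpr hndvd).symm
  have hone : addOrderOf y = 1 := by
    have := Nat.dvd_gcd h1 h2
    rw [hcop] at this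
    exact Nat.dvd_one.mp this
  have hy0 : y = 0 := AddMonoid.addOrderOf_eq_one_iff.mp hone
  simpa [hy] using congrArg Subtype.val hy0

/-- `Ш[2^∞] = 0`, rank `0` and no rational `2`-torsion give `#Sel₂ = 1` (the tree's descent count `card_selmerGroup_eq_pow_rank_mul`). -/
theorem card_selmerTwo_eq_one (W : WeierstrassCurve ℚ) [W.IsElliptic]
    (hr : W.mordellWeilRank = 0) (ht : ∀ P : W.toAffine.Point, (2 : ℕ) • P = 0 → P = 0)
    (hbot : AddCommGroup.primaryComponent W.sha 2 = ⊥) :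
    Nat.card (W.selmerGroup (2 : ℤ)) = 1 := by
  have hinst : (instDecidableEqRat : DecidableEq ℚ) = fun a b => Classical.propDecidable (a = b) := Subsingleton.elim _ _
  have htor : Nat.card (AddSubgroup.torsionBy W.toAffine.Point ((2 : ℕ) : ℤ)) = 1 := by
    have hb : AddSubgroup.torsionBy W.toAffine.Point ((2 : ℕ) : ℤ) = ⊥ :=
      (AddSubgroup.eq_bot_iff_forall _).mpr fun P hP ↦ ht P (AddSubgroup.torsionBy.nsmul_iff.mp hP)
    rw [hb, AddSubgroup.card_bot]
  rw [hinst] at htor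
  have hsha : Nat.card (W.sha ⊓ AddSubgroup.torsionBy W.galH1 ((2 : ℕ) : ℤ) : AddSubgroup W.galH1) = 1 := by
    have hb : (W.sha ⊓ AddSubgroup.torsionBy W.galH1 ((2 : ℕ) : ℤ) : AddSubgroup W.galH1) = ⊥ := by
      refine (AddSubgroup.eq_bot_iff_forall _).mpr fun c hc => ?_
      obtain ⟨hcs, hct⟩ := AddSubgroup.mem_inf.mp hc
      have h2 : (2 : ℕ) • c = 0 := AddSubgroup.torsionBy.nsmul_iff.mp hct
      have hmem : (⟨c, hcs⟩ : W.sha) ∈ AddCommGroup.primaryComponent W.sha 2 :=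
        AddCommGroup.mem_primaryComponent.mpr ⟨1, Subtype.ext (by simpa using h2)⟩
      rw [hbot] at hmem
      simpa using congrArg Subtype.val (AddSubgroup.mem_bot.mp hmem)
    rw [hb, AddSubgroup.card_bot]
  have h := card_selmerGroup_eq_pow_rank_mul W 2
  rw [hr, pow_zero, one_mul, htor, one_mul, hsha] at h
  exact_mod_cast h

/-! ## §3 The Kato half at `2`, by name: READING ∘ (A) ∘ exactness ⟹ `#Sel₂(E) = 1` -/

/-- **(A) at `(E, 2)` from the Iwasawa-1956 certificate on ONE `2`-torsion point field** (tree door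
`fineSelmerDual_moduleFinite_two_of_classicalMu_pointField` ∘ `classicalMuVanishes_of_classNumberPExp_eq_zero`; PRINT: Lim 2017 Thm. 3.5 at `2`,
Iwasawa 1956).  [cite: Lim2017FineSelmer, §3 Thm. 3.5 and Lemma 3.2] [cite: Greenberg2001IwasawaPastPresent, Prop. 2.1 p. 339] -/
theorem conjATwo_of_pointFieldIwasawaCertificate
    (hIw : iwasawa1956_classNumberPExp_eq_zero_of_not_dvd_classNumber_of_unique_prime)
    (hLim : Lim2017.thm35_at_two_fineSelmerDual_moduleFinite_of_classicalMuVanishes_of_le_divisionField_four)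
    (W : WeierstrassCurve ℚ) [W.IsElliptic] {P : geomTorsion W 2} (hP : P ≠ 0)
    (hcert : PointFieldIwasawaCertificate W P) : ConjATwo W := by
  intro κ hκ
  haveI := finiteDimensional_fixedField_stabilizer W P
  haveI : NumberField (IntermediateField.fixedField (MulAction.stabilizer (absoluteGaloisGroup ℚ) P)) :=
    NumberField.mk
  have hh' : ¬ 2 ∣ NumberField.classNumber
      (IntermediateField.fixedField (MulAction.stabilizer (absoluteGaloisGroup ℚ) P)) := by
    have := hcert.1
    rwa [NumberField.classNumber, ← Nat.card_eq_fintype_card]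
  exact fineSelmerDual_moduleFinite_two_of_classicalMu_pointField hLim W hP
    (fun κL _ => classicalMuVanishes_of_classNumberPExp_eq_zero hIw hh' hcert.2 κL) κ hκ

/-- The totally complex CARRIER `ℚ(P, i) = ℚ(P) ⊔ ℚ(i)` of a `2`-torsion point `P` (`i² = −1`): the field on which the tree's KERNEL Lim-at-`2`
door `SteinbergFibreAtTwo.PointFieldMu.exists_fineSelmerDualData_moduleFinite_of_classicalMu_pointField_adjoin` reads `μ₂ = 0` (honest for
EITHER sign of `Δ`; the cubic `ℚ(P)` itself is print-complete only for `Δ < 0`, rider of `Lim2017.thm35_at_two_…`). -/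
abbrev carrierI (W : WeierstrassCurve ℚ) [W.IsElliptic] (P : geomTorsion W 2) (i : AlgebraicClosure ℚ) :
    IntermediateField ℚ (AlgebraicClosure ℚ) :=
  IntermediateField.fixedField (MulAction.stabilizer (absoluteGaloisGroup ℚ) P) ⊔
    IntermediateField.adjoin ℚ ({i} : Set (AlgebraicClosure ℚ))

/-- **(A) at `(W, 2)` from an IWASAWA CERTIFICATE OF THE SEXTIC CARRIER `ℚ(P, i)`** — the HONEST `0 < Δ` door: one prime of `ℚ(P,i)` above `2`
and `2 ∤ h(ℚ(P,i))` ⟹ (Iwasawa 1956, PRINT `hIw`) `μ₂ = 0` for every cyclotomic `ℤ₂`-extension of `ℚ(P,i)` ⟹ (tree KERNEL, Lim 2017 Thm 3.5 /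
Lemma 3.2 at `2` proved upstairs) statement (A).  No `hLim` hypothesis: the only print input is Iwasawa's one-prime criterion.  Census ES-50B:
column IWi. -/
theorem conjATwo_of_carrierIwasawaCertificate
    (hIw : iwasawa1956_classNumberPExp_eq_zero_of_not_dvd_classNumber_of_unique_prime)
    (W : WeierstrassCurve ℚ) [W.IsElliptic] {P : geomTorsion W 2} (hP : P ≠ 0) {i : AlgebraicClosure ℚ} (hi : i ^ 2 = -1)
    (hcert : FieldIwasawaCertificateAtTwo (carrierI W P i)) : ConjATwo W := by
  intro κ hκ
  haveI := finiteDimensional_fixedField_stabilizer W P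
  have hint : IsIntegral ℚ i := by
    refine ⟨Polynomial.X ^ 2 + 1, Polynomial.monic_X_pow_add_C _ two_ne_zero, ?_⟩
    simp [hi]
  have hfd : FiniteDimensional ℚ (carrierI W P i) :=
    @IntermediateField.finiteDimensional_sup _ _ _ _ _ _ _
      (finiteDimensional_fixedField_stabilizer W P) (IntermediateField.adjoin.finiteDimensional hint)
  haveI : NumberField (carrierI W P i) := @NumberField.mk _ _ inferInstance hfd
  have hh' : ¬ 2 ∣ NumberField.classNumber (carrierI W P i) := by
    have := hcert.1
    rwa [NumberField.classNumber, ← Nat.card_eq_fintype_card]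
  exact Summit.BirchSwinnertonDyer.BirchSwinnertonDyer.Theorems.SteinbergFibreAtTwo.PointFieldMu.exists_fineSelmerDualData_moduleFinite_of_classicalMu_pointField_adjoin
    W hP hi (fun κF _ => classicalMuVanishes_of_classNumberPExp_eq_zero hIw hh' hcert.2 κF) κ hκ

/-- **ES-50K, GOOD REDUCTION AT `2`: the Kato half of ES-48X by name.**  PRINT {GZK `hGZK`}; READING {Kato-at-`2` good sharp `hK`}; INPUT (A)(E,2)
(`hA`, e.g. from `conjATwo_of_pointFieldIwasawaCertificate`); then `L(E,1) ≠ 0` and `v₂(L/Ω) = v₂(∏c_ℓ)` give `#Sel₂(E) = 1`. -/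
theorem card_selmerTwo_eq_one_of_good
    (hGZK : rank_eq_analyticRank_of_analyticRank_le_one)
    (hK : Kato2004.rankZero_padicValNat_sha_add_padicValNat_tamagawa_le_at_two_of_good_of_irreducible_of_fineSelmerDual_fg)
    (W : WeierstrassCurve ℚ) [W.IsElliptic] [W.IsGloballyMinimal]
    (hCM : ¬ W.HasCM) (hred : W.HasGoodReductionAtPrime 2) (hirr : W.HasIrreducibleModPGaloisRep 2)
    (ht : ∀ P : W.toAffine.Point, (2 : ℕ) • P = 0 → P = 0)
    (hA : ConjATwo W) (hL : W.entireLFunction 1 ≠ 0) (hx : LOverOmegaTwoExact W) :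
    Nat.card (W.selmerGroup (2 : ℤ)) = 1 := by
  have hr0 : W.analyticRank = 0 := analyticRank_eq_zero_of_entireLFunction_one_ne_zero W hL
  obtain ⟨hrk, hfin⟩ := hGZK W (by omega)
  rw [hr0] at hrk
  exact card_selmerTwo_eq_one W hrk ht
    (primaryComponent_sha_two_eq_bot W hfin (hK W hCM hred hirr hA hL hfin) hx)

/-- **ES-50K, MULTIPLICATIVE REDUCTION AT `2`** (READING: Kato-at-`2` multiplicative sharp `hK`). -/
theorem card_selmerTwo_eq_one_of_multiplicative
    (hGZK : rank_eq_analyticRank_of_analyticRank_le_one)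
    (hK : Kato2004.rankZero_padicValNat_sha_add_padicValNat_tamagawa_le_at_two_of_multiplicative_of_irreducible_of_fineSelmerDual_fg)
    (W : WeierstrassCurve ℚ) [W.IsElliptic] [W.IsGloballyMinimal]
    (hCM : ¬ W.HasCM) (hred : W.HasMultiplicativeReductionAtPrime 2) (hirr : W.HasIrreducibleModPGaloisRep 2)
    (ht : ∀ P : W.toAffine.Point, (2 : ℕ) • P = 0 → P = 0)
    (hA : ConjATwo W) (hL : W.entireLFunction 1 ≠ 0) (hx : LOverOmegaTwoExact W) :
    Nat.card (W.selmerGroup (2 : ℤ)) = 1 := by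
  have hr0 : W.analyticRank = 0 := analyticRank_eq_zero_of_entireLFunction_one_ne_zero W hL
  obtain ⟨hrk, hfin⟩ := hGZK W (by omega)
  rw [hr0] at hrk
  exact card_selmerTwo_eq_one W hrk ht
    (primaryComponent_sha_two_eq_bot W hfin (hK W hCM hred hirr hA hL hfin) hx)

/-- **ES-50K, ADDITIVE REDUCTION AT `2` WITHOUT A SPLIT MULTIPLICATIVE TWIST BY `−1`, `−2`** (READING: Kato-at-`2` additive sharp `hK`; covers every
potentially good additive curve and the potentially multiplicative ones whose `−1`- and `−2`-twists are non-split or additive at `2`). -/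
theorem card_selmerTwo_eq_one_of_additive
    (hGZK : rank_eq_analyticRank_of_analyticRank_le_one)
    (hK : Kato2004.rankZero_padicValNat_sha_add_padicValNat_tamagawa_le_at_two_of_noSplitTwistNegOneNegTwo_of_irreducible_of_fineSelmerDual_fg)
    (W : WeierstrassCurve ℚ) [W.IsElliptic] [W.IsGloballyMinimal]
    (hCM : ¬ W.HasCM) (hng : ¬ W.HasGoodReductionAtPrime 2) (hnm : ¬ W.HasMultiplicativeReductionAtPrime 2)
    (htw : ∀ d : ℚ, d = -1 ∨ d = -2 → ¬ (W.quadraticTwist d).HasSplitMultiplicativeReductionAtPrime 2)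
    (hirr : W.HasIrreducibleModPGaloisRep 2)
    (ht : ∀ P : W.toAffine.Point, (2 : ℕ) • P = 0 → P = 0)
    (hA : ConjATwo W) (hL : W.entireLFunction 1 ≠ 0) (hx : LOverOmegaTwoExact W) :
    Nat.card (W.selmerGroup (2 : ℤ)) = 1 := by
  have hr0 : W.analyticRank = 0 := analyticRank_eq_zero_of_entireLFunction_one_ne_zero W hL
  obtain ⟨hrk, hfin⟩ := hGZK W (by omega)
  rw [hr0] at hrk
  exact card_selmerTwo_eq_one W hrk ht
    (primaryComponent_sha_two_eq_bot W hfin (hK W hCM hng hnm htw hirr hA hL hfin) hx)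

/-! ## §4 Door-free typed candidates: ES-50K (Kato half of the detection statement), ES-50U (twin uniformity of the point field),
ES-50F (Fukuda certificate), ES-50R (the honest residue: Iwasawa's `μ = 0` for the `2`-division cubic fields of the slice) -/

/-- **ES-50K `KatoHalfDetectionAtTwo` (THEOREM modulo named print + the tree's Kato-at-`2` READINGS — `katoHalfDetectionAtTwo_of_readings`).**
For `E/ℚ` globally minimal, non-CM, `E[2]` irreducible, no rational `2`-torsion, reduction at `2` good, multiplicative, or additive without a split
multiplicative twist by `−1` or `−2`: statement (A) at `(E,2)`, `L(E,1) ≠ 0` and `v₂(L(E,1)/Ω) = v₂(∏ c_ℓ)` imply `#Sel₂(E) = 1`.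
This is the (⟸) half of ES-48X `SelmerDetectsAnalyticExactnessAtTwo` for the twin `W₀ = W^{(ℓ*)}` (odd torsion makes `ShaAnTwoUnit W₀ ∧ r_an = 0`
the exactness clause), with (A)(W₀,2) as the ONLY non-print input. -/
def KatoHalfDetectionAtTwo : Prop :=
  ∀ (W₀ : WeierstrassCurve ℚ) [W₀.IsElliptic] [W₀.IsGloballyMinimal], ¬ W₀.HasCM → W₀.HasIrreducibleModPGaloisRep 2 →
    (∀ P : W₀.toAffine.Point, (2 : ℕ) • P = 0 → P = 0) →
    (W₀.HasGoodReductionAtPrime 2 ∨ W₀.HasMultiplicativeReductionAtPrime 2 ∨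
      (¬ W₀.HasGoodReductionAtPrime 2 ∧ ¬ W₀.HasMultiplicativeReductionAtPrime 2 ∧
        ∀ d : ℚ, d = -1 ∨ d = -2 → ¬ (W₀.quadraticTwist d).HasSplitMultiplicativeReductionAtPrime 2)) →
    ConjATwo W₀ → W₀.entireLFunction 1 ≠ 0 → LOverOmegaTwoExact W₀ →
      Nat.card (W₀.selmerGroup (2 : ℤ)) = 1

/-- **ES-50K is a theorem modulo {GZK} ∪ {the three Kato-at-`2` sharp READINGS}.** -/
theorem katoHalfDetectionAtTwo_of_readings
    (hGZK : rank_eq_analyticRank_of_analyticRank_le_one)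
    (hKg : Kato2004.rankZero_padicValNat_sha_add_padicValNat_tamagawa_le_at_two_of_good_of_irreducible_of_fineSelmerDual_fg)
    (hKm : Kato2004.rankZero_padicValNat_sha_add_padicValNat_tamagawa_le_at_two_of_multiplicative_of_irreducible_of_fineSelmerDual_fg)
    (hKa : Kato2004.rankZero_padicValNat_sha_add_padicValNat_tamagawa_le_at_two_of_noSplitTwistNegOneNegTwo_of_irreducible_of_fineSelmerDual_fg) :
    KatoHalfDetectionAtTwo := by
  intro W₀ _ _ hCM hirr ht hred hA hL hx
  rcases hred with hg | hm | ⟨hng, hnm, htw⟩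
  · exact card_selmerTwo_eq_one_of_good hGZK hKg W₀ hCM hg hirr ht hA hL hx
  · exact card_selmerTwo_eq_one_of_multiplicative hGZK hKm W₀ hCM hm hirr ht hA hL hx
  · exact card_selmerTwo_eq_one_of_additive hGZK hKa W₀ hCM hng hnm htw hirr ht hA hL hx

/-- **ES-50U `TwinPointFieldUniform` (THEOREM-CANDIDATE, size S; folklore).**  A quadratic twist (followed by any change of variables) does not change
the `2`-torsion point fields: if `W₀ = C • W^{(d)}` then every non-zero `P ∈ W[2]` has a partner `P₀ ∈ W₀[2]`, `P₀ ≠ 0`, with `ℚ(P₀) = ℚ(P)` as subfields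
of `ℚ̄` (the `x`-coordinates of the `2`-torsion are moved by the rational affine map `x ↦ u²·d·x + r`).  Consequence: every point-field certificate
for (A) at `2` — Iwasawa's, Fukuda's, `μ = 0` itself — is decided ONCE per base curve `W` for the whole twin family `{W^{(d)}}`. [folklore]
[cite: SilvermanAEC2009, X.2 Prop. 2.4 and III.1] -/
def TwinPointFieldUniform : Prop :=
  ∀ (W W₀ : WeierstrassCurve ℚ) [W.IsElliptic] [W₀.IsElliptic] (d : ℚ),
    (∃ C : WeierstrassCurve.VariableChange ℚ, C • W.quadraticTwist d = W₀) →
    ∀ (P : geomTorsion W 2), P ≠ 0 →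
      ∃ P₀ : geomTorsion W₀ 2, P₀ ≠ 0 ∧
        IntermediateField.fixedField (MulAction.stabilizer (absoluteGaloisGroup ℚ) P₀) =
          IntermediateField.fixedField (MulAction.stabilizer (absoluteGaloisGroup ℚ) P)

/-- Transport of the Iwasawa certificate along ES-50U: the certificate of the base curve serves every twin. -/
theorem pointFieldIwasawaCertificate_twin (hU : TwinPointFieldUniform)
    (W W₀ : WeierstrassCurve ℚ) [W.IsElliptic] [W₀.IsElliptic] (d : ℚ)
    (htw : ∃ C : WeierstrassCurve.VariableChange ℚ, C • W.quadraticTwist d = W₀)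
    {P : geomTorsion W 2} (hP : P ≠ 0) (hcert : PointFieldIwasawaCertificate W P) :
    ∃ P₀ : geomTorsion W₀ 2, P₀ ≠ 0 ∧ PointFieldIwasawaCertificate W₀ P₀ := by
  obtain ⟨P₀, hP₀, hF⟩ := hU W W₀ d htw P hP
  refine ⟨P₀, hP₀, ?_⟩
  unfold PointFieldIwasawaCertificate at hcert ⊢
  exact hF ▸ hcert

/-- **(A) at `2` for EVERY twin from ONE certificate of the base curve** (ES-50U ∘ Iwasawa door). -/
theorem conjATwo_twin_of_pointFieldIwasawaCertificate (hU : TwinPointFieldUniform)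
    (hIw : iwasawa1956_classNumberPExp_eq_zero_of_not_dvd_classNumber_of_unique_prime)
    (hLim : Lim2017.thm35_at_two_fineSelmerDual_moduleFinite_of_classicalMuVanishes_of_le_divisionField_four)
    (W W₀ : WeierstrassCurve ℚ) [W.IsElliptic] [W₀.IsElliptic] (d : ℚ)
    (htw : ∃ C : WeierstrassCurve.VariableChange ℚ, C • W.quadraticTwist d = W₀)
    {P : geomTorsion W 2} (hP : P ≠ 0) (hcert : PointFieldIwasawaCertificate W P) : ConjATwo W₀ := by
  obtain ⟨P₀, hP₀, hc₀⟩ := pointFieldIwasawaCertificate_twin hU W W₀ d htw hP hcert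
  exact conjATwo_of_pointFieldIwasawaCertificate hIw hLim W₀ hP₀ hc₀

/-- **TWIN UNIFORMITY FOR THE CARRIER CERTIFICATE**: under ES-50U the sextic carrier `ℚ(P, i)` of a twin `W₀` equals that of `W`, so ONE
Iwasawa certificate of `ℚ(P,i)` gives (A) at `(W₀, 2)` for every twin `W₀` — either sign of `Δ`, no `hLim`. -/
theorem conjATwo_twin_of_carrierIwasawaCertificate (hU : TwinPointFieldUniform)
    (hIw : iwasawa1956_classNumberPExp_eq_zero_of_not_dvd_classNumber_of_unique_prime)
    (W W₀ : WeierstrassCurve ℚ) [W.IsElliptic] [W₀.IsElliptic] (d : ℚ)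
    (htw : ∃ C : WeierstrassCurve.VariableChange ℚ, C • W.quadraticTwist d = W₀)
    {P : geomTorsion W 2} (hP : P ≠ 0) {i : AlgebraicClosure ℚ} (hi : i ^ 2 = -1)
    (hcert : FieldIwasawaCertificateAtTwo (carrierI W P i)) : ConjATwo W₀ := by
  obtain ⟨P₀, hP₀, hF⟩ := hU W W₀ d htw P hP
  have hcert₀ : FieldIwasawaCertificateAtTwo (carrierI W₀ P₀ i) := by
    have h := hcert
    simp only [carrierI] at h ⊢
    exact hF ▸ h
  exact conjATwo_of_carrierIwasawaCertificate hIw W₀ hP₀ hi hcert₀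

/-- **ES-50F: (A) at `(E, 2)` from the FUKUDA certificate on one `2`-torsion point field** — two consecutive layers `n₀ ≤ n, n+1` of the cyclotomic
`ℤ₂`-tower of `ℚ(P)` with equal `ord₂ h` (tree door `finite_fineSelmer_twoTorsion_of_classNumberPExp_succ_eq_pointField`, here in the `∃ γ D`
currency).  Numerically (census ES-50): `n₀ = 0` and `ord₂ h(ℚ(P)) = ord₂ h(ℚ(P, √2))`, or `n₀ = 1` and `ord₂ h(ℚ(P,√2)) = ord₂ h(ℚ(P,√(2+√2)))`.
[cite: Fukuda1994, Thm. 1 (1), p. 264] [cite: Lim2017FineSelmer, §3 Thm. 3.5 and Lemma 3.2] -/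
theorem conjATwo_of_pointFieldFukudaCertificate
    (hF1 : fukuda1994_thm1_classNumberPExp_const_of_succ_eq)
    (hLim : Lim2017.thm35_at_two_fineSelmerDual_moduleFinite_of_classicalMuVanishes_of_le_divisionField_four)
    (W : WeierstrassCurve ℚ) [W.IsElliptic] {P : geomTorsion W 2} (hP : P ≠ 0) {n₀ n : ℕ} (hn : n₀ ≤ n)
    (hram : ∀ κL : ZpExtension
        (IntermediateField.fixedField (MulAction.stabilizer (absoluteGaloisGroup ℚ) P)) 2,
      κL.IsCyclotomic → TotallyRamifiedFrom κL n₀)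
    (hh : ∀ κL : ZpExtension
        (IntermediateField.fixedField (MulAction.stabilizer (absoluteGaloisGroup ℚ) P)) 2,
      κL.IsCyclotomic → classNumberPExp κL (n + 1) = classNumberPExp κL n) : ConjATwo W := by
  intro κ hκ
  haveI := finiteDimensional_fixedField_stabilizer W P
  haveI : NumberField (IntermediateField.fixedField (MulAction.stabilizer (absoluteGaloisGroup ℚ) P)) :=
    NumberField.mk
  exact fineSelmerDual_moduleFinite_two_of_classicalMu_pointField hLim W hP
    (fun κL hκL => classicalMuVanishes_of_classNumberPExp_succ_eq hF1 κL (hram κL hκL) hn (hh κL hκL)) κ hκ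

/-- **ES-50R `SlicePointFieldMuZero` (CONJECTURE-GRADE; the honest residue of the Kato half on the 23715 slice).**  Iwasawa's `μ = 0` for the cyclotomic
`ℤ₂`-extension of the `2`-division cubic field `ℚ(P)` of every slice curve — an instance of Iwasawa's `μ`-conjecture [cite: Iwasawa1973MuInvariants, §1]
(known for abelian `ℚ(P)` by Ferrero–Washington, NOT for the `S₃`-cubics of the slice); per curve it is a finite class-group computation (census ES-50:
Iwasawa / Fukuda certificates).  By ES-50U it is a property of the twin FAMILY; with Lim 2017 Thm. 3.5 at `2` it gives (A) at `2` for every twin. -/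
def SlicePointFieldMuZero : Prop :=
  ∀ (W : WeierstrassCurve ℚ) [W.IsElliptic] [W.IsGloballyMinimal],
    ¬ W.HasCM → (∀ n : ℕ, W.HasSurjectiveModNGaloisRep ((2 ^ n : ℕ) : ℤ)) → Odd W.torsionOrder → Odd W.tamagawaProduct →
    W.analyticRank = 1 →
    ∀ (P : geomTorsion W 2), P ≠ 0 →
      FieldMuZeroAtTwo (IntermediateField.fixedField (MulAction.stabilizer (absoluteGaloisGroup ℚ) P))

/-- **NET (kernel): ES-50R ∧ ES-50U ∧ Lim-at-`2` ⟹ (A) at `2` for every twin of every slice curve.** -/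
theorem conjATwo_twin_of_slicePointFieldMuZero (hR : SlicePointFieldMuZero) (hU : TwinPointFieldUniform)
    (hLim : Lim2017.thm35_at_two_fineSelmerDual_moduleFinite_of_classicalMuVanishes_of_le_divisionField_four)
    (W : WeierstrassCurve ℚ) [W.IsElliptic] [W.IsGloballyMinimal]
    (hCM : ¬ W.HasCM) (hIm : ∀ n : ℕ, W.HasSurjectiveModNGaloisRep ((2 ^ n : ℕ) : ℤ)) (hT : Odd W.torsionOrder)
    (hTam : Odd W.tamagawaProduct) (hr : W.analyticRank = 1)
    {P : geomTorsion W 2} (hP : P ≠ 0)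
    (W₀ : WeierstrassCurve ℚ) [W₀.IsElliptic] (d : ℚ) (htw : ∃ C : WeierstrassCurve.VariableChange ℚ, C • W.quadraticTwist d = W₀) :
    ConjATwo W₀ := by
  obtain ⟨P₀, hP₀, hF⟩ := hU W W₀ d htw P hP
  intro κ hκ
  haveI := finiteDimensional_fixedField_stabilizer W₀ P₀
  haveI : NumberField (IntermediateField.fixedField (MulAction.stabilizer (absoluteGaloisGroup ℚ) P₀)) :=
    NumberField.mk
  have hμ : FieldMuZeroAtTwo (IntermediateField.fixedField (MulAction.stabilizer (absoluteGaloisGroup ℚ) P)) :=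
    hR W hCM hIm hT hTam hr P hP
  have hμ₀ : FieldMuZeroAtTwo (IntermediateField.fixedField (MulAction.stabilizer (absoluteGaloisGroup ℚ) P₀)) := hF ▸ hμ
  exact fineSelmerDual_moduleFinite_two_of_classicalMu_pointField hLim W₀ hP₀ hμ₀ κ hκ

end Summit.BirchSwinnertonDyer.BirchSwinnertonDyer.Cruxes.RankOneAtTwoBigImageOddLocal.ES50

end
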